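import Literature.IUT.LogThetaLattice.TensorPacketsProofs
import HarnessLib

/-!
# [IUTchIII] Prop 3.1 (ii), integral-structure clause: the FACT row F-2127 DECIDED as typed

Proof-only companion (abc-iut cell, L6 home, L-F register row LF6-23 of `plan/L6/LF-IUT.tsv`;
FACT-LIST row F-2127 `Prop31ii_integralStructures`; DAG node IUTchIII:Prop3.1(ii)) of
`Literature/IUT/LogThetaLattice/TensorPackets.lean` (S. Mochizuki, *Inter-universal Teichmüller
theory III*, kurims manuscript (May 2020), §3, Proposition 3.1 (ii) p. 93; claim key Mochizuki2012,
DISPUTED, D-0012 — the content decided here is undisputed commutative algebra). NO definitions,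
NO instances, NO new `Prop` facts; every theorem is about the objects typed there.

The typed clause

  `Prop31ii_integralStructures 𝕜 L O α v := ∀ ι K (e : log(^{A,α}𝓕_v) ≃+* Π_i K_i) i,`
  `  Injective (log(^α𝓕_v) → K_i) ∧ ∃ O_i ⊆ K_i, O α v = (log(^α𝓕_v) → K_i)⁻¹ O_i`

is a SCHEMA over an arbitrary family of commutative `𝕜`-algebras `L α v = log(^α𝓕_v)`.

* **Instance forms are the content and HOLD** (`Prop31ii_integralStructures_of_field`): for EVERY
  family of FIELDS `L α v` — the printed situation ("direct sums of ind-topological fields") and both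
  models of record: the finite level `log(^α𝓕_v) := K_v` (abc-iut-w4-d019
  `LogShellBridge.prop31ii_integralStructures_model`, `LogShellIdentificationBridge.lean`) and the
  [IUTchIII] Remark 3.1.1 (i) level `log(^α𝓕_v) := k̄_v`
  (`LogShellBridge.prop31ii_integralStructures_algClosure_model` below) — by abc-iut-L6-t5's
  `Prop31ii_integralStructures_of_isField` (a ring homomorphism out of a field is injective).
* **The universal closure is NOT a fact** (`not_Prop31ii_integralStructures_boolFun`,
  `not_forall_Prop31ii_integralStructures`): at the non-field fibre `log(^α𝓕_v) := ℚ × ℚ`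
  (functions `Bool → ℚ`; one capsule index, one place) the packet `log(^{A,α}𝓕_v) = (ℚ×ℚ) ⊗_ℚ ℚ`
  decomposes as the product of the two fields `ℚ`, and the composite to either factor kills a
  nontrivial idempotent, so it is not injective.  (FACT-LIST rule R5: a refuted closure is never a
  fact; the row is DECIDED: schema refuted as typed, instance forms proved at the models.)

Honest framing: nothing here bears on [IUTchIII] Cor. 3.12 or asserts abc proved or refuted; no side
taken; typed ≠ proved for the disputed corpus — this is bookkeeping of OUR typed statement.
-/

namespace Literature.IUT.LogThetaLattice

open scoped TensorProduct
open PiTensorProduct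

universe u v v' w

/-! ### 1. Instance forms: every field-valued interface -/

section Fields

variable (𝕜 : Type u) [Field 𝕜]
variable {A : Type v} {Vfib : Type v'}
variable (L : A → Vfib → Type w) [∀ α v, Field (L α v)] [∀ α v, Algebra 𝕜 (L α v)]

/-- **IUTchIII:Prop3.1(ii)** (kurims p.93), integral-structure clause — BINDER-FREE INSTANCE FORM:
whenever every `log(^α𝓕_v)` is a field (the printed "ind-topological fields"), the typed clause
`Prop31ii_integralStructures 𝕜 L O α v` holds for every integral structure `O`, every label `α` and
every place `v` (abc-iut-L6-t5 `Prop31ii_integralStructures_of_isField`).  Node id IUTchIII:Prop3.1(ii);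
FACT row F-2127. [claim: Mochizuki2012, status: disputed] -/
theorem Prop31ii_integralStructures_of_field (O : ∀ α v, Subring (L α v)) (α : A) (v : Vfib) :
    Prop31ii_integralStructures 𝕜 L O α v :=
  Prop31ii_integralStructures_of_isField 𝕜 L O α v (Field.toIsField (L α v))

end Fields

/-- **IUTchIII:Prop3.1(ii)** / **Rmk 3.1.1 (i)** (kurims p.93): the integral-structure clause HOLDS at
the Remark 3.1.1 (i) model `log(^α𝓕_v) := k̄_v` (an algebraic closure of the completion `K_v`, copies
labelled by `α ∈ A`), for every integral structure `O` (e.g. `𝒪_{k̄_v}`), over any base field `𝕜`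
(e.g. `ℚ_{v_ℚ}`) over which the `K_v` are algebras.  Companion of abc-iut-w4-d019's finite-level
`LogShellBridge.prop31ii_integralStructures_model`.  FACT row F-2127.
[claim: Mochizuki2012, status: disputed] -/
theorem LogShellBridge.prop31ii_integralStructures_algClosure_model (𝕜 : Type u) [Field 𝕜]
    {A : Type v} {Vfib : Type v'} (K : Vfib → Type w) [∀ v, Field (K v)] [∀ v, Algebra 𝕜 (K v)]
    (O : A → ∀ v : Vfib, Subring (AlgebraicClosure (K v))) (α : A) (v : Vfib) :
    Prop31ii_integralStructures 𝕜 (fun (_ : A) (v : Vfib) => AlgebraicClosure (K v)) O α v :=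
  Prop31ii_integralStructures_of_field 𝕜 (fun (_ : A) (v : Vfib) => AlgebraicClosure (K v)) O α v

/-! ### 2. The universal closure is refutable: a non-field fibre

The witness interface: ONE capsule index (`A = Unit`), ONE place (`Vfib = Unit`), base field `ℚ`, and
the non-field fibre `log(^α𝓕_v) := (Bool → ℚ) ≅ ℚ × ℚ`.  The complementary tensor factor
`⊗_{β ∈ A∖{α}} log(^β𝓕_{v_ℚ})` is then indexed by the EMPTY type `{β : Unit // β ≠ ()}`. -/

/-- The empty tensor product of `ℚ`-algebras is `ℚ`: the structure map `ℚ → ⊗_∅` is an isomorphism of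
`ℚ`-algebras, with inverse the lift of the constant multilinear map `1` (existence form; no definition
is introduced). [folklore] -/
private theorem nonempty_algEquiv_emptyFactor :
    Nonempty ((⨂[ℚ] β : {β : Unit // β ≠ ()},
      Packet1 (fun (_ : Unit) (_ : Unit) => Bool → ℚ) β.1) ≃ₐ[ℚ] ℚ) := by
  haveI : IsEmpty {β : Unit // β ≠ ()} := ⟨fun β => β.2 (Subsingleton.elim _ _)⟩
  exact ⟨AlgEquiv.ofAlgHom
    (PiTensorProduct.liftAlgHom (MultilinearMap.constOfIsEmpty ℚ _ (1 : ℚ)) rfl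
      (fun _ _ => (mul_one (1 : ℚ)).symm))
    (Algebra.ofId ℚ _)
    (by ext)
    (PiTensorProduct.algHom_ext fun β => isEmptyElim β)⟩

/-- The witness packet decomposes into two fields:
`log(^{A,α}𝓕_v) = (Bool → ℚ) ⊗_ℚ (⊗_∅) ≅ (Bool → ℚ) ⊗_ℚ ℚ ≅ (Bool → ℚ) = Π_{i ∈ Bool} ℚ`
(existence form; no definition is introduced). [folklore] -/
private theorem nonempty_witnessDecomposition :
    Nonempty (PacketAt ℚ (fun (_ : Unit) (_ : Unit) => Bool → ℚ) () () ≃+* (Bool → ℚ)) := by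
  obtain ⟨eZ⟩ := nonempty_algEquiv_emptyFactor
  exact ⟨((Algebra.TensorProduct.congr (AlgEquiv.refl (R := ℚ) (A₁ := Bool → ℚ)) eZ).trans
    (Algebra.TensorProduct.rid ℚ ℚ (Bool → ℚ))).toRingEquiv⟩

/-- **IUTchIII:Prop3.1(ii)** (kurims p.93) — the typed schema `Prop31ii_integralStructures` FAILS at the
non-field fibre `log(^α𝓕_v) := ℚ × ℚ` (one capsule index, one place), for EVERY choice of integral
structure `O`: along a decomposition `log(^{A,α}𝓕_v) ≅ ℚ × ℚ` into two fields, the composite ring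
homomorphism `ℚ × ℚ → ℚ` to the first factor sends the orthogonal idempotents `(1,0)`, `(0,1)` to
elements with product `0` in the field `ℚ`, so one of them — a nonzero element — is killed: the map is
not injective.  FACT row F-2127 is refuted AS A UNIVERSAL CLOSURE (rule R5); its instance forms at
fields (`Prop31ii_integralStructures_of_field`) are the content. [claim: Mochizuki2012, status: disputed] -/
theorem not_Prop31ii_integralStructures_boolFun (O : Unit → Unit → Subring (Bool → ℚ)) :
    ¬ Prop31ii_integralStructures ℚ (fun (_ : Unit) (_ : Unit) => Bool → ℚ) O () () := by
  intro h
  obtain ⟨e⟩ := nonempty_witnessDecomposition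
  obtain ⟨hinj, -⟩ := h Bool inferInstance (fun _ => ℚ) inferInstance e true
  -- the composite as a ring homomorphism `(Bool → ℚ) →+* ℚ`
  let φ : (Bool → ℚ) →+* ℚ :=
    (Pi.evalRingHom (fun _ : Bool => ℚ) true).comp
      (e.toRingHom.comp (toPacketAt ℚ (fun (_ : Unit) (_ : Unit) => Bool → ℚ) () ()).toRingHom)
  have hφ : Function.Injective φ := hinj
  -- the two orthogonal idempotents of `ℚ × ℚ`
  have hab : (Pi.single true 1 : Bool → ℚ) * Pi.single false 1 = 0 := by
    funext b; cases b <;> simp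
  have h0 : φ (Pi.single true 1) * φ (Pi.single false 1) = 0 := by
    rw [← map_mul, hab, map_zero]
  rcases mul_eq_zero.mp h0 with h1 | h1
  · have := hφ (h1.trans (map_zero φ).symm)
    exact one_ne_zero (congr_fun this true |>.trans (by simp))
  · have := hφ (h1.trans (map_zero φ).symm)
    exact one_ne_zero (congr_fun this false |>.trans (by simp))

/-- **IUTchIII:Prop3.1(ii)** (kurims p.93) — the UNIVERSAL CLOSURE of the typed schema
`Prop31ii_integralStructures` (over all base fields, index sets, algebra families, integral structures,
labels and places) is FALSE (witness `not_Prop31ii_integralStructures_boolFun`).  FACT row F-2127: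
DECIDED — schema refuted as typed; instance forms at field-valued interfaces proved
(`Prop31ii_integralStructures_of_field`, `LogShellBridge.prop31ii_integralStructures_model`,
`LogShellBridge.prop31ii_integralStructures_algClosure_model`). [claim: Mochizuki2012, status: disputed] -/
theorem not_forall_Prop31ii_integralStructures :
    ¬ ∀ (𝕜 : Type) [Field 𝕜] (A : Type) [Fintype A] [DecidableEq A] (Vfib : Type) [Fintype Vfib]
        [DecidableEq Vfib] (L : A → Vfib → Type) [∀ α v, CommRing (L α v)]
        [∀ α v, Algebra 𝕜 (L α v)] (O : ∀ α v, Subring (L α v)) (α : A) (v : Vfib),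
        Prop31ii_integralStructures 𝕜 L O α v :=
  fun h => not_Prop31ii_integralStructures_boolFun (fun _ _ => ⊥)
    (h ℚ Unit Unit (fun (_ : Unit) (_ : Unit) => Bool → ℚ) _ () ())

end Literature.IUT.LogThetaLattice
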